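import Summits.Parity.GeneralizedHardyLittlewood.Theses.PolynomialKatai
import Summits.Parity.GeneralizedHardyLittlewood.Theorems.PairsToGHL.Negative.UnboundedSiegelZeros
import Literature.Barriers.Parity.SiegelZeroPrimePairs
import Literature.Barriers.Parity.SiegelZeroDichotomy
import HarnessLib

/-!
# Crux `RelativePairsToGHL` (stmt-Parity-15917), negative lane — truth table and Siegel vacuity

`RelativePairsToGHL := RelativePairs → GeneralizedHardyLittlewood` (route files `PolynomialKatai` and
`LiouvilleOpening`, one shared ledger item; the two route decls agree by `Iff.rfl`, checked in the
refuter's scratch file and deliberately not imported here).  Findings of the birth vetting, all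
kernel-checked:

* `relativePairsToGHL_truthTable` — the antecedent is itself a CONSEQUENCE of the summit conjunct
  (Green–Tao Conj. 1.2 at `d = 1, t = 2` has the absolute error `εN ≤ ε(1+|∏_p β_p|)N`), hence
  `(RelativePairsToGHL ∧ RelativePairs) ↔ GeneralizedHardyLittlewood`
  (the crux joined with the routes' target IS the summit conjunct, no normalisation slack) and
  `¬RelativePairsToGHL ↔ RelativePairs ∧ ¬GeneralizedHardyLittlewood`: an unconditional refutation is a
  PROOF of shift-uniform relative Hardy–Littlewood for pairs (twin primes included) together with a
  refutation of Green–Tao's Conjecture 1.2.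
* `relativePairs_siegelGuard` — modulo the vendored Matomäki–Merikoski Theorem 1.3
  (`MatomakiMerikoski2023_pairCorrelation`), `RelativePairs → ¬UnboundedSiegelZeros`: the antecedent is
  shift-uniform (`‖Ψ‖_N ≤ L` allows constants up to `L·N`), so it contains `(n, n + 2q)` at `N = q^{10}`,
  `L = 3`, `K = [-N, N]`, where `β_∞ = N` and the relative error `ε(1 + 𝔖(2q))N` cannot absorb the
  DOUBLING of the main term forced by an exceptional zero (same computation as the tree's
  `not_generalizedHardyLittlewood_of_unboundedSiegelZeros` and `AbsoluteUpgrade.stub_siegelGuard`).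
* `illusory_world_vacuity` — so in the only known consistent world in which the consequent is refutable
  (`UnboundedSiegelZeros`, tree: `not_generalizedHardyLittlewood_of_unboundedSiegelZeros`) the antecedent
  fails too: BOTH ends of the implication are false there and the crux holds vacuously.  No
  Siegel-zero-based refutation of `RelativePairsToGHL` exists; a disproof must first PROVE `RelativePairs`.
[folklore]
-/

noncomputable section

namespace Summit.Parity.GeneralizedHardyLittlewood.Theorems.RelativePairsToGHL.Negative

open Finset Filter MeasureTheory
open scoped Topology ArithmeticFunction.vonMangoldt
open Literature.NumberTheory.Sieve Literature.Barriers.Parity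
open Summit.Parity.GeneralizedHardyLittlewood.Theses.PolynomialKatai (RelativePairs RelativePairsToGHL)
open Summit.Parity.GeneralizedHardyLittlewood.Theorems.PairsToGHL.Negative

/-! ### Truth-functional position of the crux -/

/-- **Truth table of the crux** (one conjunction, so that no component poses as a proof of an item):
(i) it is implied by the summit conjunct; (ii) so is its antecedent — Green–Tao's Conjecture 1.2 at
`d = 1`, `t = 2` has the absolute error `ε N ≤ ε (1 + |∏_p β_p|) N`; (iii) it holds vacuously if the
antecedent fails; (iv) joined with the routes' target `RelativePairs` it IS the summit conjunct, with no
normalisation slack; (v) its negation is `RelativePairs ∧ ¬GeneralizedHardyLittlewood`.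
[cite: GreenTao2010, Conj. 1.2] -/
theorem relativePairsToGHL_truthTable :
    (_root_.GeneralizedHardyLittlewood → RelativePairsToGHL) ∧
    (_root_.GeneralizedHardyLittlewood → RelativePairs) ∧
    (¬ RelativePairs → RelativePairsToGHL) ∧
    ((RelativePairsToGHL ∧ RelativePairs) ↔ _root_.GeneralizedHardyLittlewood) ∧
    (¬ RelativePairsToGHL ↔ (RelativePairs ∧ ¬ _root_.GeneralizedHardyLittlewood)) := by
  -- (ii): the antecedent is a consequence of the summit conjunct
  have hRP : _root_.GeneralizedHardyLittlewood → RelativePairs := by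
    intro hG L ε hε
    obtain ⟨N₀, hN₀⟩ := hG 1 2 L le_rfl (by norm_num) ε hε
    refine ⟨N₀, fun N hN Ψ hΨ hL K hK hKN => ?_⟩
    have h1 := hN₀ N hN Ψ hΨ hL K hK hKN
    rw [pow_one] at h1
    refine h1.trans ?_
    have hN0 : (0 : ℝ) ≤ N := Nat.cast_nonneg N
    have h2 : 0 ≤ ε * |singularProduct Ψ| * (N : ℝ) := by positivity
    have h3 : ε * (1 + |singularProduct Ψ|) * (N : ℝ) = ε * N + ε * |singularProduct Ψ| * N := by
      ring
    rw [h3]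
    linarith
  refine ⟨fun h _ => h, hRP, fun h hR => absurd hR h,
    ⟨fun h => h.1 h.2, fun h => ⟨fun _ => h, hRP h⟩⟩, ?_⟩
  unfold RelativePairsToGHL
  constructor
  · intro h
    by_cases hR : RelativePairs
    · exact ⟨hR, fun hG => h fun _ => hG⟩
    · exact absurd (fun hR' => absurd hR' hR) h
  · rintro ⟨hR, hG⟩ h
    exact hG (h hR)

/-! ### The Siegel guard for pairs -/

-- proof adapted from `AbsoluteUpgrade.stub_siegelGuard` (Theorems/LeeYangFibresAbsoluteUpgradeSiegelGuard.lean)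
-- and `not_generalizedHardyLittlewood_of_unboundedSiegelZeros`, with the error `ε (1 + |𝔖|) N` of `RelativePairs`
/-- **Relative Hardy–Littlewood for pairs bounds the quality of Siegel zeros.** Modulo the vendored
theorem of Matomäki–Merikoski (`MatomakiMerikoski2023_pairCorrelation`, Theorem 1.3),
`RelativePairs → ¬UnboundedSiegelZeros`.  At the system `(n, n + 2q)`, `N = X = q^{10}`, `L = 3`,
`K = [-N, N]` the Green–Tao dictionary gives `β_∞ = N`, `∏_p β_p = 𝔖(2q) ≥ C₂ · 2q/φ(2q)`
(`singularProduct_shiftPairSystem`, `twinPrimeConst_mul_le_goldbachSingularSeries`), and `RelativePairs`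
at `ε₀ = min (1/2) (C₂/8)` predicts `|∑_{n ≤ N} Λ(n)Λ(n+2q) - N𝔖(2q)| ≤ ε₀ (1 + 𝔖(2q)) N`, whereas a real
zero `1 - 1/(η log q)` of a primitive quadratic `L(s, χ) mod q` gives `2N𝔖(2q)` up to
`K (2q/φ(2q)) N (e^{-√(10 log η)} + e^{-(log N)^{1/2}} + 10 log⁶η/η)` (`mm_correction_two_mul`); for `η`, `q`
large (supplied by `UnboundedSiegelZeros`) the two are incompatible.
[cite: MatomakiMerikoski2023, Theorem 1.3] [cite: GreenTao2010, Conj. 1.2] -/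
theorem relativePairs_siegelGuard :
    MatomakiMerikoski2023_pairCorrelation → RelativePairs → ¬ UnboundedSiegelZeros := by
  intro hMM hR hU
  have hC₂ : 0 < twinPrimeConst := twinPrimeConst_pos_holds
  obtain ⟨K, hK, hMM'⟩ := hMM 1 le_rfl (1 / 10) (by norm_num) 1 one_pos
  set δ : ℝ := twinPrimeConst / (12 * K) with hδ
  have hδpos : 0 < δ := by positivity
  -- relative Hardy–Littlewood for pairs at `L = 3`, `ε₀ = min (1/2) (C₂/8)`
  set ε₀ : ℝ := min (1 / 2) (twinPrimeConst / 8) with hε₀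
  have hε₀pos : 0 < ε₀ := lt_min (by norm_num) (by positivity)
  have hε₀half : ε₀ ≤ 1 / 2 := min_le_left _ _
  have hε₀C : ε₀ ≤ twinPrimeConst / 8 := min_le_right _ _
  obtain ⟨N₀, hN₀⟩ := hR 3 ε₀ hε₀pos
  -- thresholds: the three error terms of Matomäki–Merikoski are eventually `≤ δ`
  have hT1 : ∀ᶠ η : ℝ in atTop, Real.exp (-1 * Real.sqrt (10 * Real.log η)) ≤ δ := by
    have h1 : Tendsto (fun η : ℝ => Real.exp (-1 * Real.sqrt (10 * Real.log η))) atTop (𝓝 0) := by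
      refine Real.tendsto_exp_atBot.comp ?_
      have : Tendsto (fun η : ℝ => Real.sqrt (10 * Real.log η)) atTop atTop :=
        Real.tendsto_sqrt_atTop.comp (Real.tendsto_log_atTop.const_mul_atTop (by norm_num))
      simpa using this.const_mul_atTop_of_neg (by norm_num : (-1 : ℝ) < 0)
    exact (h1.eventually (gt_mem_nhds hδpos)).mono fun _ h => h.le
  have hT2 : ∀ᶠ η : ℝ in atTop, 10 * Real.log η ^ (6 : ℕ) / η ≤ δ := by
    have h1 : Tendsto (fun η : ℝ => 10 * Real.log η ^ (6 : ℕ) / η) atTop (𝓝 0) := by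
      have := (Real.tendsto_pow_log_div_mul_add_atTop 1 0 6 one_ne_zero).const_mul 10
      rw [mul_zero] at this
      refine this.congr' (Eventually.of_forall fun η => ?_)
      simp only [one_mul, add_zero]
      ring
    exact (h1.eventually (gt_mem_nhds hδpos)).mono fun _ h => h.le
  have hT3 : ∀ᶠ X : ℝ in atTop, Real.exp (-1 * Real.log X ^ (3 / 5 - 1 / 10 : ℝ)) ≤ δ := by
    have h1 : Tendsto (fun X : ℝ => Real.exp (-1 * Real.log X ^ (3 / 5 - 1 / 10 : ℝ))) atTop
        (𝓝 0) := by
      refine Real.tendsto_exp_atBot.comp ?_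
      have : Tendsto (fun X : ℝ => Real.log X ^ (3 / 5 - 1 / 10 : ℝ)) atTop atTop :=
        (tendsto_rpow_atTop (by norm_num)).comp Real.tendsto_log_atTop
      simpa using this.const_mul_atTop_of_neg (by norm_num : (-1 : ℝ) < 0)
    exact (h1.eventually (gt_mem_nhds hδpos)).mono fun _ h => h.le
  obtain ⟨η₁, hη₁⟩ := eventually_atTop.mp (hT1.and hT2)
  obtain ⟨X₁, hX₁⟩ := eventually_atTop.mp hT3
  -- a Siegel zero of quality `η ≥ η₁` at a conductor `q ≥ max N₀ ⌈X₁⌉ 2`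
  obtain ⟨q, inst, χ, η, hq, hη, hprim, hquad, hη10, hL⟩ := hU η₁ (max N₀ (max ⌈X₁⌉₊ 2))
  have hqN₀ : N₀ ≤ q := le_of_max_le_left hq
  have hqX₁ : ⌈X₁⌉₊ ≤ q := le_of_max_le_left (le_of_max_le_right hq)
  have hq2 : 2 ≤ q := le_of_max_le_right (le_of_max_le_right hq)
  have hqpos : 0 < q := by omega
  set N : ℕ := q ^ 10 with hN
  have hNpos : 0 < N := pow_pos hqpos 10
  have hNr : (0 : ℝ) < N := by exact_mod_cast hNpos
  have hqN : q ≤ N := by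
    calc q = q ^ 1 := (pow_one q).symm
      _ ≤ q ^ 10 := Nat.pow_le_pow_right hqpos (by norm_num)
  have h2qN : 2 * q ≤ N := by
    calc 2 * q ≤ q * q := Nat.mul_le_mul_right q hq2
      _ = q ^ 2 := (sq q).symm
      _ ≤ q ^ 10 := Nat.pow_le_pow_right hqpos (by norm_num)
  set X : ℝ := (q : ℝ) ^ (10 : ℝ) with hXdef
  have hXN : X = (N : ℝ) := by
    rw [hXdef, hN, show (10 : ℝ) = ((10 : ℕ) : ℝ) by norm_num, Real.rpow_natCast, Nat.cast_pow]
  -- Matomäki–Merikoski at `h = 2q`, `V = 10`, `X = q^10`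
  have hA : ((2 * q : ℕ) : ℝ) ≤ 1 * X := by
    rw [hXN, one_mul]; exact_mod_cast h2qN
  have hM := hMM' q hq2 χ hprim hquad η hη10 hL 10 X le_rfl hXdef (2 * q) (by omega) hA
  rw [mm_correction_two_mul hqpos, hXN, Nat.floor_natCast] at hM
  -- relative Hardy–Littlewood for `(n, n + 2q)` on `[-N, N]`
  have hnd : IsNondegenerateSystem (shiftPairSystem ((2 * q : ℕ) : ℤ)) :=
    isNondegenerateSystem_shiftPairSystem_iff.mpr (by exact_mod_cast (show 2 * q ≠ 0 by omega))
  have hRq := hN₀ N (hqN₀.trans hqN) (shiftPairSystem ((2 * q : ℕ) : ℤ)) hnd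
    (affLinSize_shiftPairSystem_le hNpos h2qN) (realBox 1 N) (convex_Icc _ _) subset_rfl
  rw [vonMangoldtSum_shiftPairSystem, archFactor_shiftPairSystem,
    singularProduct_shiftPairSystem (even_two_mul q) (by omega)] at hRq
  -- bookkeeping
  set S : ℝ := ∑ n ∈ Icc 1 N, Λ n * Λ (n + 2 * q) with hS
  set 𝔖 : ℝ := goldbachSingularSeries (2 * q) with h𝔖
  set ρ : ℝ := ((2 * q : ℕ) : ℝ) / (Nat.totient (2 * q) : ℝ) with hρ
  have hρ1 : 1 ≤ ρ := by
    have hφpos : (0 : ℝ) < (Nat.totient (2 * q) : ℝ) := by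
      exact_mod_cast Nat.totient_pos.mpr (by omega)
    rw [hρ, le_div_iff₀ hφpos, one_mul]
    exact_mod_cast Nat.totient_le (2 * q)
  have hρ0 : 0 ≤ ρ := zero_le_one.trans hρ1
  have h𝔖ρ : twinPrimeConst * ρ ≤ 𝔖 :=
    twinPrimeConst_mul_le_goldbachSingularSeries (even_two_mul q) (by omega)
  have h𝔖0 : 0 ≤ 𝔖 := (mul_nonneg hC₂.le hρ0).trans h𝔖ρ
  -- the relative error `ε₀ (1 + |𝔖|) N` of `RelativePairs` is `ε₀ (N𝔖 + N)` here (`𝔖 ≥ 0`)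
  have hRq' : |S - (N : ℝ) * 𝔖| ≤ ε₀ * ((N : ℝ) * 𝔖 + N) := by
    have h1 : |S - (N : ℝ) * 𝔖| ≤ ε₀ * (1 + |𝔖|) * N := hRq
    rw [abs_of_nonneg h𝔖0] at h1
    calc |S - (N : ℝ) * 𝔖| ≤ ε₀ * (1 + 𝔖) * N := h1
      _ = ε₀ * ((N : ℝ) * 𝔖 + N) := by ring
  clear hRq
  obtain ⟨hE1, hE2⟩ := hη₁ η hη
  have hX₁N : X₁ ≤ (N : ℝ) :=
    (Nat.le_ceil X₁).trans (by exact_mod_cast hqX₁.trans hqN)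
  have hE3 := hX₁ (N : ℝ) hX₁N
  -- `N𝔖 ≤ |S - 2N𝔖| + |S - N𝔖| ≤ KρN·3δ + ε₀ (N𝔖 + N)`
  have hKρN : 0 ≤ K * ρ * (N : ℝ) := mul_nonneg (mul_nonneg hK.le hρ0) hNr.le
  have key : (N : ℝ) * 𝔖 ≤ K * ρ * N * (3 * δ) + ε₀ * ((N : ℝ) * 𝔖 + N) := by
    have hM' : |S - (N : ℝ) * 𝔖 * 2| ≤ K * ρ * N * (3 * δ) :=
      hM.trans (mul_le_mul_of_nonneg_left (by linarith) hKρN)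
    have ha := neg_abs_le (S - (N : ℝ) * 𝔖 * 2)
    have hb := le_abs_self (S - (N : ℝ) * 𝔖)
    linarith
  have h3δ : K * ρ * (N : ℝ) * (3 * δ) = (N : ℝ) * (twinPrimeConst * ρ / 4) := by
    rw [hδ]; field_simp; ring
  rw [h3δ] at key
  have hfin : 𝔖 ≤ twinPrimeConst * ρ / 4 + ε₀ * 𝔖 + ε₀ := by
    have h' : (N : ℝ) * 𝔖 ≤ (N : ℝ) * (twinPrimeConst * ρ / 4 + ε₀ * 𝔖 + ε₀) := by
      have : (N : ℝ) * (twinPrimeConst * ρ / 4 + ε₀ * 𝔖 + ε₀) =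
          (N : ℝ) * (twinPrimeConst * ρ / 4) + ε₀ * ((N : ℝ) * 𝔖 + N) := by ring
      linarith
    exact le_of_mul_le_mul_left h' hNr
  have hε𝔖 : ε₀ * 𝔖 ≤ 1 / 2 * 𝔖 := mul_le_mul_of_nonneg_right hε₀half h𝔖0
  have hCρ : twinPrimeConst * 1 ≤ twinPrimeConst * ρ := mul_le_mul_of_nonneg_left hρ1 hC₂.le
  linarith

/-- Contrapositive: **Siegel zeros of unbounded quality refute shift-uniform relative Hardy–Littlewood
for pairs** (the routes' target `RelativePairs`), modulo Matomäki–Merikoski Theorem 1.3.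
[cite: MatomakiMerikoski2023, Theorem 1.3] -/
theorem not_relativePairs_of_unboundedSiegelZeros (hMM : MatomakiMerikoski2023_pairCorrelation)
    (hU : UnboundedSiegelZeros) : ¬ RelativePairs :=
  fun hR => relativePairs_siegelGuard hMM hR hU

/-- **Illusory-world vacuity of the crux.** Modulo Matomäki–Merikoski Theorem 1.3, in the world
`UnboundedSiegelZeros` — the only known consistent world in which the consequent
`GeneralizedHardyLittlewood` is refutable (tree: `not_generalizedHardyLittlewood_of_unboundedSiegelZeros`) —
the antecedent `RelativePairs` fails as well: both ends of `RelativePairsToGHL` are false there, so the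
implication holds vacuously and no Siegel-zero witness can refute it (contrast the fixed-shift residual
`PairsToGHL`, which is FALSE there: `pairsToGHL_false_of_unboundedSiegelZeros`).
[cite: MatomakiMerikoski2023, Theorem 1.3] -/
theorem illusory_world_vacuity (hMM : MatomakiMerikoski2023_pairCorrelation)
    (hU : UnboundedSiegelZeros) :
    ¬ RelativePairs ∧ ¬ _root_.GeneralizedHardyLittlewood ∧
      ¬ (RelativePairs ∧ ¬ _root_.GeneralizedHardyLittlewood) :=
  ⟨not_relativePairs_of_unboundedSiegelZeros hMM hU,
    not_generalizedHardyLittlewood_of_unboundedSiegelZeros hMM hU,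
    fun h => not_relativePairs_of_unboundedSiegelZeros hMM hU h.1⟩

/-- **Any refutation of the crux bounds Siegel zeros** (it must prove `RelativePairs`): from
`¬RelativePairsToGHL`, modulo Matomäki–Merikoski, there are `η₀`, `q₀` such that no primitive quadratic
character of conductor `q ≥ q₀` has a Siegel zero of quality `η ≥ η₀`. [cite: MatomakiMerikoski2023, Theorem 1.3] -/
theorem siegelZeros_bounded_of_not_relativePairsToGHL (hMM : MatomakiMerikoski2023_pairCorrelation)
    (h : ¬ RelativePairsToGHL) :
    ∃ η₀ : ℝ, ∃ q₀ : ℕ, ∀ (q : ℕ) [NeZero q] (χ : DirichletCharacter ℂ q) (η : ℝ),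
      q₀ ≤ q → IsSiegelZero χ η → η < η₀ := by
  have hR : RelativePairs := (relativePairsToGHL_truthTable.2.2.2.2.mp h).1
  have hnot : ¬ UnboundedSiegelZeros := relativePairs_siegelGuard hMM hR
  unfold UnboundedSiegelZeros at hnot
  simp only [not_forall, not_exists, not_and] at hnot
  obtain ⟨η₀, q₀, hη⟩ := hnot
  refine ⟨η₀, q₀, fun q inst χ η hq hS => ?_⟩
  by_contra hlt
  exact hη q inst χ η hq (not_lt.mp hlt) hS

end Summit.Parity.GeneralizedHardyLittlewood.Theorems.RelativePairsToGHL.Negative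

end
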